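import Summits.BirchSwinnertonDyer.BirchSwinnertonDyer.Theorems.CountingDoorF2AtThreeSelmerAverageRankMoment
import Summits.BirchSwinnertonDyer.BirchSwinnertonDyer.Theorems.CountingDoorF2AtThreeSelmerAverageFloor
import HarnessLib

/-!
# BirchSwinnertonDyer / CountingDoorF2AtThree — crux I1 `SelmerThreeAverageLargeF2`
# (stmt-BirchSwinnertonDyer-19440): the RANK-`≥ 4` SHARE CAP, an instrument of I1 that needs only LOWER
# bounds on the rank

Route `route-BirchSwinnertonDyer-CountingDoorF2AtThree` (cell bsd-rank2, leaf T-r2). Companion of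
`Theorems/CountingDoorF2AtThreeSelmerAverageRankMoment.lean` (p582870: I1 ⇒ `limsup avg 3^rank ≤ 36`) and
`…SelmerAverageFloor.lean` (p594862: the floor `9`). The exponential rank moment is the sharpest rank
instrument of I1 but its per-member datum is the EXACT rank (a descent upper bound per curve). This file
records the coarser instrument whose per-member datum is only a LOWER bound `rank E_a(ℚ) ≥ 4` (four
independent rational points — a certificate, no descent, no Ш):

* `one_add_eighty_mul_indicator_le_three_pow`: `1 + 80·𝟙[4 ≤ r] ≤ 3^r` for every `r : ℕ`; with the generic
  floor, `one_add_indicators_le_three_pow`: `1 + 8·𝟙[Q] + 72·𝟙[4 ≤ r] ≤ 3^r` whenever `Q → 2 ≤ r`.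
* `one_add_eighty_mul_proportionOn_le_averageOn_selmerThree`: on a nonempty height ball of any `Φ ⊆ F₂`,
  `1 + 80 · prop_{Φ(<X)}(rank ≥ 4) ≤ avg_{Φ(<X)} #Sel₃` (Kummer: `3^rank ≤ #Sel₃`,
  `three_pow_mordellWeilRank_le_natCard_selmerGroup`).
* `rankFourShare_le_of_selmerThreeAverageLE`: `Φ.AverageOnLE #Sel₃ c` (`c ≥ 1`) ⇒ for every `ε > 0`,
  eventually `prop_{Φ(<X)}(rank ≥ 4) ≤ (c − 1)/80 + ε`.
* **`rankFourShare_le_of_selmerThreeAverageLargeF2`**: the route decl I1 (BY NAME) ⇒ on every large `Φ`,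
  `limsup_X prop_{Φ(<X)}(rank E_a(ℚ) ≥ 4) ≤ 7/16` (ε-form); **`rankFourShare_le_three_eighths_of_selmerThreeAverageLargeF2`**:
  modulo the route's fact pack `LargeFamilyInputsF2` (Bhargava–Ho Thm 10.1 ∧ Thm 9.1: rank `≥ 2` for 100 %
  of every large `Φ` with nonempty residues) the cap improves to `3/8`
  (`1 + 8·prop(rank ≥ 2) + 72·prop(rank ≥ 4) ≤ avg #Sel₃`, `prop(rank ≥ 2) → 1`).
* `not_selmerThreeAverageLargeF2_of_frequently_rankFourShare`: the falsifier — ONE large `Φ`, one `ε > 0`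
  and `prop_{Φ(<X)}(rank ≥ 4) > 7/16 + ε` for infinitely many `X` refute I1; every member counted on the
  left needs only a certificate of four independent points.

NUMBERS (instrument readings of record, bsd-rank2-sel3-p2 GEN 3 memo LOCAL-SPREAD-GEN3 v2 = evidence #24 on
the item, kit j293320/j295264, PARI `ellrank`, tuple-weighted WINDOW shares of F₂): rank-`≥ 4` share
`.176 / .209 / .241 / .268 / .287` on `[10⁹,10¹⁰) … [10¹²,10¹³)` (still rising; `.48` among the `w = +1`
members at `10¹³`), against the I1 caps `7/16 = .4375` (unconditional form) and `3/8 = .375` (with the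
generic floor); the cumulative shares `prop_{F₂(<X)}` are smaller than the window values. I1 is a limsup
statement: no finite height decides it; the cap says what a certified rank-`≥ 4` census would have to
exceed, persistently, to refute I1 on a given large `Φ`.

HONEST FRAMING (B1). Bookkeeping (Kummer injection + averaging) that types an instrument of an OPEN crux;
nothing reads an analytic rank; no S0 motion; I1 is neither proved nor refuted; BSD is not proved by any of
this. PARTITION: none — r_an ≥ 2, summit axis S0; TWIN (D-0056): n/a.

References: J. Silverman, AEC X.4.2 (Kummer sequence) [SilvermanAEC2009]; M. Bhargava, W. Ho,
arXiv:2207.03309 (2022), Thm. 1.3, Thm. 9.1, Thm. 10.1 [BhargavaHo2022]; B. Poonen, E. Rains, J. AMS 25 (2012)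
(the model value `36`) [PoonenRains2012].
-/

set_option linter.dupNamespace false

noncomputable section

open scoped Classical
open Filter Topology Finset
open WeierstrassCurve Literature.NumberTheory.EllipticCurves
  Literature.NumberTheory.EllipticCurves.BhargavaHo2022
  Summit.BirchSwinnertonDyer.Rank2
  Summit.BirchSwinnertonDyer.BirchSwinnertonDyer.Theses.CountingDoorF2AtThree

namespace Summit.BirchSwinnertonDyer.BirchSwinnertonDyer.Theorems

/-! ### §1 Pointwise: the indicator of `rank ≥ 4` under the exponential moment -/

/-- `1 + 80·𝟙[4 ≤ r] ≤ 3^r` for every natural number `r` (`r ≤ 3`: `1 ≤ 3^r`; `r ≥ 4`: `81 ≤ 3^r`). [folklore] -/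
theorem one_add_eighty_mul_indicator_le_three_pow (r : ℕ) {hd : Decidable (4 ≤ r)} :
    (1 : ℝ) + 80 * (if 4 ≤ r then (1 : ℝ) else 0) ≤ (3 : ℝ) ^ r := by
  by_cases h : 4 ≤ r
  · rw [if_pos h, mul_one]
    have h81 : (3 : ℝ) ^ 4 ≤ (3 : ℝ) ^ r := pow_le_pow_right₀ (by norm_num) h
    linarith [show (3 : ℝ) ^ 4 = 81 by norm_num]
  · rw [if_neg h, mul_zero, add_zero]
    exact one_le_pow₀ (by norm_num)

/-- With a floor property `Q` implying `2 ≤ r`: `1 + 8·𝟙[Q] + 72·𝟙[4 ≤ r] ≤ 3^r`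
(`r ≤ 1`: `Q` fails, `1 ≤ 3^r`; `r ∈ {2,3}`: `9 ≤ 3^r`; `r ≥ 4`: `81 ≤ 3^r`). [folklore] -/
theorem one_add_indicators_le_three_pow {Q : Prop} {hQd : Decidable Q} (r : ℕ) {hd : Decidable (4 ≤ r)}
    (hQ : Q → 2 ≤ r) :
    (1 : ℝ) + 8 * (if Q then (1 : ℝ) else 0) + 72 * (if 4 ≤ r then (1 : ℝ) else 0) ≤ (3 : ℝ) ^ r := by
  have h8 : (8 : ℝ) * (if Q then (1 : ℝ) else 0) ≤ 8 * (if 2 ≤ r then (1 : ℝ) else 0) := by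
    by_cases hq : Q
    · rw [if_pos hq, if_pos (hQ hq)]
    · rw [if_neg hq, mul_zero]
      split_ifs <;> norm_num
  by_cases h4 : 4 ≤ r
  · have h2 : 2 ≤ r := le_trans (by norm_num) h4
    rw [if_pos h4, mul_one]
    rw [if_pos h2, mul_one] at h8
    have h81 : (3 : ℝ) ^ 4 ≤ (3 : ℝ) ^ r := pow_le_pow_right₀ (by norm_num) h4
    linarith [show (3 : ℝ) ^ 4 = 81 by norm_num]
  · rw [if_neg h4, mul_zero, add_zero]
    by_cases h2 : 2 ≤ r
    · rw [if_pos h2, mul_one] at h8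
      have h9 : (3 : ℝ) ^ 2 ≤ (3 : ℝ) ^ r := pow_le_pow_right₀ (by norm_num) h2
      linarith [show (3 : ℝ) ^ 2 = 9 by norm_num]
    · rw [if_neg h2, mul_zero] at h8
      have h1 : (1 : ℝ) ≤ (3 : ℝ) ^ r := one_le_pow₀ (by norm_num)
      linarith

/-- Member-wise: `1 + 80·𝟙[4 ≤ rank E_a(ℚ)] ≤ #Sel₃(E_a)` for every member `a` of `F₂` (Kummer injection
`3^rank ≤ #Sel₃`). [cite: SilvermanAEC2009, Thm X.4.2] -/
theorem one_add_eighty_mul_indicator_le_natCard_selmerGroup (a : Params) (ha : a.IsMember)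
    {hd : Decidable (4 ≤ a.curve.mordellWeilRank)} :
    (1 : ℝ) + 80 * (if 4 ≤ a.curve.mordellWeilRank then (1 : ℝ) else 0) ≤
      (Nat.card (a.curve.selmerGroup 3) : ℝ) :=
  (one_add_eighty_mul_indicator_le_three_pow _).trans (three_pow_mordellWeilRank_le_natCard_selmerGroup a ha)

/-! ### §2 Finite height balls: `1 + 80·prop(rank ≥ 4) ≤ avg #Sel₃` -/

/-- The average of the constant `1` over a NONEMPTY height ball is `1`. [folklore] -/
theorem averageOn_one_of_card_pos (Φ : CongruenceFamily₂) {X : ℕ} (hpos : 0 < (Φ.below X).card) :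
    Φ.averageOn (fun _ ↦ (1 : ℝ)) X = 1 := by
  rw [averageOn_eq_sum_div, Finset.sum_const, nsmul_eq_mul, mul_one]
  exact div_self (by exact_mod_cast hpos.ne')

/-- On an EMPTY height ball every proportion is the junk value `0`. [folklore] -/
theorem proportionOn_of_card_eq_zero (Φ : CongruenceFamily₂) (P : Params → Prop) {X : ℕ}
    (h0 : (Φ.below X).card = 0) : Φ.proportionOn P X = 0 := by
  rw [proportionOn_eq_card_filter_div Φ P X, h0, Nat.cast_zero, div_zero]

/-- **`1 + 80 · prop_{Φ(<X)}(rank ≥ 4) ≤ avg_{Φ(<X)} #Sel₃`** on every nonempty height ball of any subfamily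
`Φ ⊆ F₂`. [cite: SilvermanAEC2009, Thm X.4.2] -/
theorem one_add_eighty_mul_proportionOn_le_averageOn_selmerThree (Φ : CongruenceFamily₂) {X : ℕ}
    (hpos : 0 < (Φ.below X).card) :
    1 + 80 * Φ.proportionOn (fun a ↦ 4 ≤ a.curve.mordellWeilRank) X ≤
      Φ.averageOn (fun a ↦ (Nat.card (a.curve.selmerGroup 3) : ℝ)) X := by
  rw [← averageOn_one_of_card_pos Φ hpos, ← averageOn_const_mul_indicator, ← averageOn_add]
  exact averageOn_mono Φ (fun a ha ↦ one_add_eighty_mul_indicator_le_natCard_selmerGroup a ha.1) X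

/-- With the floor: `1 + 8 · prop(torsion = 1 ∧ rank ≥ 2) + 72 · prop(rank ≥ 4) ≤ avg #Sel₃` on every
nonempty height ball. [cite: SilvermanAEC2009, Thm X.4.2] -/
theorem one_add_proportions_le_averageOn_selmerThree (Φ : CongruenceFamily₂) {X : ℕ}
    (hpos : 0 < (Φ.below X).card) :
    1 + 8 * Φ.proportionOn (fun a ↦ a.curve.torsionOrder = 1 ∧ 2 ≤ a.curve.mordellWeilRank) X +
        72 * Φ.proportionOn (fun a ↦ 4 ≤ a.curve.mordellWeilRank) X ≤
      Φ.averageOn (fun a ↦ (Nat.card (a.curve.selmerGroup 3) : ℝ)) X := by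
  rw [← averageOn_one_of_card_pos Φ hpos, ← averageOn_const_mul_indicator, ← averageOn_const_mul_indicator,
    ← averageOn_add, ← averageOn_add]
  refine averageOn_mono Φ (fun a ha ↦ ?_) X
  exact (one_add_indicators_le_three_pow (Q := a.curve.torsionOrder = 1 ∧ 2 ≤ a.curve.mordellWeilRank)
    a.curve.mordellWeilRank (fun h ↦ h.2)).trans (three_pow_mordellWeilRank_le_natCard_selmerGroup a ha.1)

/-! ### §3 The cap: `limsup prop(rank ≥ 4) ≤ (c − 1)/80`, i.e. `≤ 7/16` under I1 -/

/-- **Rank-`≥ 4` share cap from a `3`-Selmer average bound.** On any `Φ ⊆ F₂`: if `Φ.AverageOnLE #Sel₃ c`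
with `c ≥ 1`, then for every `ε > 0`, eventually `prop_{Φ(<X)}(rank E_a(ℚ) ≥ 4) ≤ (c − 1)/80 + ε`.
[cite: SilvermanAEC2009, Thm X.4.2] -/
theorem rankFourShare_le_of_selmerThreeAverageLE (Φ : CongruenceFamily₂) {c : ℝ} (hc : 1 ≤ c)
    (h : Φ.AverageOnLE (fun a ↦ (Nat.card (a.curve.selmerGroup 3) : ℝ)) c) {ε : ℝ} (hε : 0 < ε) :
    ∀ᶠ X : ℕ in atTop, Φ.proportionOn (fun a ↦ 4 ≤ a.curve.mordellWeilRank) X ≤ (c - 1) / 80 + ε := by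
  refine (h (80 * ε) (by positivity)).mono fun X hX ↦ ?_
  rcases Nat.eq_zero_or_pos (Φ.below X).card with h0 | hpos
  · rw [proportionOn_of_card_eq_zero Φ _ h0]
    have : 0 ≤ (c - 1) / 80 := by apply div_nonneg <;> linarith
    linarith
  · have hball := one_add_eighty_mul_proportionOn_le_averageOn_selmerThree Φ hpos
    have : 80 * Φ.proportionOn (fun a ↦ 4 ≤ a.curve.mordellWeilRank) X ≤ (c - 1) + 80 * ε := by linarith
    have h80 : Φ.proportionOn (fun a ↦ 4 ≤ a.curve.mordellWeilRank) X ≤ ((c - 1) + 80 * ε) / 80 := by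
      rw [le_div_iff₀ (by norm_num : (0 : ℝ) < 80)]; linarith
    calc Φ.proportionOn (fun a ↦ 4 ≤ a.curve.mordellWeilRank) X ≤ ((c - 1) + 80 * ε) / 80 := h80
      _ = (c - 1) / 80 + ε := by ring

/-- The same cap in the tree's `AverageOnLE` currency (limsup of the proportion = limsup of the average of the
indicator): `Φ.AverageOnLE #Sel₃ c` (`c ≥ 1`) ⇒ `Φ.AverageOnLE 𝟙[rank ≥ 4] ((c − 1)/80)`. [cite: SilvermanAEC2009, Thm X.4.2] -/
theorem averageOnLE_indicator_rankFour_of_selmerThreeAverageLE (Φ : CongruenceFamily₂) {c : ℝ} (hc : 1 ≤ c)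
    (h : Φ.AverageOnLE (fun a ↦ (Nat.card (a.curve.selmerGroup 3) : ℝ)) c) :
    Φ.AverageOnLE (fun a ↦ if 4 ≤ a.curve.mordellWeilRank then (1 : ℝ) else 0) ((c - 1) / 80) := by
  intro ε hε
  refine (rankFourShare_le_of_selmerThreeAverageLE Φ hc h hε).mono fun X hX ↦ ?_
  rwa [← proportionOn_eq_averageOn]

/-- **I1 ⇒ the rank-`≥ 4` share cap `7/16` on every large family.** The route decl `SelmerThreeAverageLargeF2`
(BY NAME) implies: for every large `Φ ⊆ F₂` and every `ε > 0`, eventually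
`prop_{Φ(<X)}(rank E_a(ℚ) ≥ 4) ≤ 7/16 + ε` (`(36 − 1)/80 = 7/16`). Readings of record (window shares of F₂,
sel3-p2 GEN 3): `.176 … .287` on `[10⁹, 10¹³)`, rising. [cite: BhargavaHo2022, Thm. 1.3 (ranks in F₂)]
[cite: SilvermanAEC2009, Thm X.4.2] -/
theorem rankFourShare_le_of_selmerThreeAverageLargeF2 (h1 : SelmerThreeAverageLargeF2)
    (Φ : CongruenceFamily₂) (hΦ : Φ.IsLarge) {ε : ℝ} (hε : 0 < ε) :
    ∀ᶠ X : ℕ in atTop, Φ.proportionOn (fun a ↦ 4 ≤ a.curve.mordellWeilRank) X ≤ 7 / 16 + ε := by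
  have h := rankFourShare_le_of_selmerThreeAverageLE Φ (by norm_num) (h1 Φ hΦ) hε
  norm_num at h ⊢
  exact h

/-- The same in the `AverageOnLE` currency: I1 ⇒ `Φ.AverageOnLE 𝟙[rank ≥ 4] (7/16)` on every large `Φ`.
[cite: SilvermanAEC2009, Thm X.4.2] -/
theorem averageOnLE_indicator_rankFour_of_selmerThreeAverageLargeF2 (h1 : SelmerThreeAverageLargeF2)
    (Φ : CongruenceFamily₂) (hΦ : Φ.IsLarge) :
    Φ.AverageOnLE (fun a ↦ if 4 ≤ a.curve.mordellWeilRank then (1 : ℝ) else 0) (7 / 16) := by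
  have h := averageOnLE_indicator_rankFour_of_selmerThreeAverageLE Φ (by norm_num) (h1 Φ hΦ)
  norm_num at h
  exact h

/-! ### §4 With the generic floor (modulo `LargeFamilyInputsF2`): the cap `3/8` -/

/-- **I1 + the fact pack ⇒ the rank-`≥ 4` share cap `3/8`.** Modulo `LargeFamilyInputsF2` (= Bhargava–Ho
Thm 10.1 ∧ Thm 9.1: on every large `Φ` with a nonempty residue set at every prime, 100 % of members have
trivial torsion and rank `≥ 2`), `SelmerThreeAverageLargeF2` implies: for every such `Φ` and every `ε > 0`,
eventually `prop_{Φ(<X)}(rank ≥ 4) ≤ 3/8 + ε` (`1 + 8·(1 − δ) + 72·x ≤ 36 + ε'` forces `x ≤ 27/72 + …`).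
[cite: BhargavaHo2022, Thm. 9.1 and Thm. 10.1] [cite: SilvermanAEC2009, Thm X.4.2] -/
theorem rankFourShare_le_three_eighths_of_selmerThreeAverageLargeF2 (hL : LargeFamilyInputsF2)
    (h1 : SelmerThreeAverageLargeF2) (Φ : CongruenceFamily₂) (hΦ : Φ.IsLarge)
    (hne : ∀ p : ℕ, p.Prime → (Φ.residues p).Nonempty) {ε : ℝ} (hε : 0 < ε) :
    ∀ᶠ X : ℕ in atTop, Φ.proportionOn (fun a ↦ 4 ≤ a.curve.mordellWeilRank) X ≤ 3 / 8 + ε := by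
  have hgen : Φ.HasDensityOn (fun a ↦ a.curve.torsionOrder = 1 ∧ 2 ≤ a.curve.mordellWeilRank) 1 :=
    thm9_1_F2.hasDensityOn_torsionOrder_rank_of_isLarge hL.2 hL.1 Φ hΦ hne
  have hD := densityOnGE_of_hasDensityOn Φ hgen (9 * ε / 2) (by positivity)
  refine (((h1 Φ hΦ) (36 * ε) (by positivity)).and hD).mono fun X hX ↦ ?_
  obtain ⟨hA, hδ⟩ := hX
  rcases Nat.eq_zero_or_pos (Φ.below X).card with h0 | hpos
  · rw [proportionOn_of_card_eq_zero Φ _ h0]; linarith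
  · have hball := one_add_proportions_le_averageOn_selmerThree Φ hpos
    have h72 : 72 * Φ.proportionOn (fun a ↦ 4 ≤ a.curve.mordellWeilRank) X ≤ 27 + 72 * ε := by linarith
    linarith

/-! ### §5 The falsifier in its correct (limsup) shape, with a lower-bound-only datum -/

/-- **Formal falsifier of I1 through the rank-`≥ 4` share.** ONE large `Φ ⊆ F₂` and one `ε > 0` such that
`prop_{Φ(<X)}(rank E_a(ℚ) ≥ 4) > 7/16 + ε` for infinitely many height bounds `X` refute
`SelmerThreeAverageLargeF2`; each member counted needs only a certificate of FOUR independent rational points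
(a lower bound on the rank), no descent upper bound and no Ш. (With the fact pack the threshold is `3/8`.)
[cite: SilvermanAEC2009, Thm X.4.2] -/
theorem not_selmerThreeAverageLargeF2_of_frequently_rankFourShare (Φ : CongruenceFamily₂) (hΦ : Φ.IsLarge)
    {ε : ℝ} (hε : 0 < ε)
    (hfreq : ∃ᶠ X : ℕ in atTop, 7 / 16 + ε < Φ.proportionOn (fun a ↦ 4 ≤ a.curve.mordellWeilRank) X) :
    ¬ SelmerThreeAverageLargeF2 := fun h1 ↦ by
  obtain ⟨X, hlt, hle⟩ := (hfreq.and_eventually (rankFourShare_le_of_selmerThreeAverageLargeF2 h1 Φ hΦ hε)).exists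
  exact absurd hle (not_le.mpr hlt)

/-- The `3/8` falsifier, modulo the fact pack: one large `Φ` with nonempty residues, one `ε > 0` and
`prop_{Φ(<X)}(rank ≥ 4) > 3/8 + ε` for infinitely many `X` refute I1 (given `LargeFamilyInputsF2`).
[cite: BhargavaHo2022, Thm. 9.1 and Thm. 10.1] -/
theorem not_selmerThreeAverageLargeF2_of_frequently_rankFourShare_three_eighths (hL : LargeFamilyInputsF2)
    (Φ : CongruenceFamily₂) (hΦ : Φ.IsLarge) (hne : ∀ p : ℕ, p.Prime → (Φ.residues p).Nonempty)
    {ε : ℝ} (hε : 0 < ε)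
    (hfreq : ∃ᶠ X : ℕ in atTop, 3 / 8 + ε < Φ.proportionOn (fun a ↦ 4 ≤ a.curve.mordellWeilRank) X) :
    ¬ SelmerThreeAverageLargeF2 := fun h1 ↦ by
  obtain ⟨X, hlt, hle⟩ :=
    (hfreq.and_eventually (rankFourShare_le_three_eighths_of_selmerThreeAverageLargeF2 hL h1 Φ hΦ hne hε)).exists
  exact absurd hle (not_le.mpr hlt)

end Summit.BirchSwinnertonDyer.BirchSwinnertonDyer.Theorems

end
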